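import Summits.Ventures.CertifiedManyBodySolver.Theorems.TcThermcert1SaddleCriticalPoint
import Mathlib
import HarnessLib

/-!
# Saddle geometry on the fugacity torus, part 5: Cauchy bounds for the perturbation gradient and the base point

Helper file for route `TcThermcert1`, crux `ThermalStiffnessCeilingU8b10_le_1o8` (item `stmt-Ventures-26381`), line
`Cruxes/ThermalStiffnessCeilingU8b10_le_1o8/Lines/zerofree_corridor.lean` v8, registered stub `stub_saddleGeometry` (K3b); steps S1–S2 of
`Cruxes/ThermalStiffnessCeilingU8b10_le_1o8/STUB-PLAN-stub_saddleGeometry.md`.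

For `h : ℂ × ℂ → ℂ` analytic on the annulus square `A × A`, `A = {2/3 < |ζ| < 8/9}` (literally the line's `fugAnnulus`), with
`‖h‖ ≤ ε` there, the partial gradient is `∂_z h(p) = fderiv h p (1,0)`, `∂_w h(p) = fderiv h p (0,1)` (`hasDerivAt_fst_slice`,
`hasDerivAt_snd_slice`), and by Cauchy estimates on discs of radius `1/40`:

* `norm_fderiv_fst_le`, `norm_fderiv_snd_le`: `‖∂h‖ ≤ 40ε` on the bidisc `D' = B̄(7/9, 29/360)²`;
* `norm_fderiv_sub_fst_le`, `norm_fderiv_sub_snd_le`: `∂h` is `1600ε`-Lipschitz in each variable on `D = B̄(7/9, 1/18)²`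
  (second Cauchy estimate + mean value inequality);
* `perturbation_bounds`: the perturbations `P₁ = z∂_z h`, `P₂ = w∂_w h` satisfy `‖Pᵢ‖ ≤ 34ε` and are `2800ε`-Lipschitz
  (sup norm) on `D`;
* `exists_saddle_base_point` (**S2**): for `ε ≤ 1/28000` and real `α, β` within `1/300` of `7/16`, the perturbed saddle equations
  `z/(1+z) + z∂_z h(z,w) = α`, `w/(1+w) + w∂_w h(z,w) = β` have a solution `(z₀,w₀) ∈ D` (part 2,
  `exists_perturbed_saddle_point`), with `‖z₀∂_z h‖, ‖w₀∂_w h‖ ≤ 34ε` and `(z₀,w₀)` within `(81/25)·34ε`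
  of the real unperturbed saddle `(α/(1−α), β/(1−β))` — the K3b prover takes `r₁ = ‖z₀‖`, `φ₀ = arg z₀`
  and reads off `|Im z₀| ≤ 111ε`, `13/18 ≤ r₁ ≤ 15/18`.

[folklore] No definitions; no `sorry`.
-/

noncomputable section

open Complex Metric Set

namespace Summit.Ventures.CertifiedManyBodySolver.Theorems.TcThermcert1.ZeroFreeCorridor

/-! ## §6 Cauchy bounds for the perturbation gradient on the bidisc, and the base point -/

/-- One-variable Cauchy estimate on a closed disc: `‖f'(c)‖ ≤ B/d` if `f` is complex differentiable on `B̄(c,d)` and bounded by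
`B` there. -/
theorem norm_deriv_le_of_closedBall {f : ℂ → ℂ} {c : ℂ} {d B : ℝ} (hd : 0 < d)
    (hf : DifferentiableOn ℂ f (closedBall c d)) (hB : ∀ z ∈ closedBall c d, ‖f z‖ ≤ B) : ‖deriv f c‖ ≤ B / d :=
  Complex.norm_deriv_le_of_forall_mem_sphere_norm_le hd (hf.diffContOnCl_ball subset_rfl)
    fun z hz => hB z (sphere_subset_closedBall hz)

/-- The `z`-partial of `h : ℂ × ℂ → ℂ` at a point of differentiability is `fderiv h p (1,0)`. -/
theorem hasDerivAt_fst_slice {h : ℂ × ℂ → ℂ} {p : ℂ × ℂ} (hh : DifferentiableAt ℂ h p) :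
    HasDerivAt (fun z : ℂ => h (z, p.2)) (fderiv ℂ h p (1, 0)) p.1 := by
  have hc : HasDerivAt (fun z : ℂ => (z, p.2)) (1, 0) p.1 := (hasDerivAt_id p.1).prodMk (hasDerivAt_const p.1 p.2)
  exact hh.hasFDerivAt.comp_hasDerivAt p.1 hc

/-- The `w`-partial of `h : ℂ × ℂ → ℂ` at a point of differentiability is `fderiv h p (0,1)`. -/
theorem hasDerivAt_snd_slice {h : ℂ × ℂ → ℂ} {p : ℂ × ℂ} (hh : DifferentiableAt ℂ h p) :
    HasDerivAt (fun w : ℂ => h (p.1, w)) (fderiv ℂ h p (0, 1)) p.2 := by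
  have hc : HasDerivAt (fun w : ℂ => (p.1, w)) (0, 1) p.2 := (hasDerivAt_const p.2 p.1).prodMk (hasDerivAt_id p.2)
  exact hh.hasFDerivAt.comp_hasDerivAt p.2 hc

/-- Norm bookkeeping around `7/9`: `‖z − 7/9‖ ≤ δ` implies `7/9 − δ ≤ ‖z‖ ≤ 7/9 + δ`. -/
theorem norm_bounds_of_near_seven_ninths {z : ℂ} {δ : ℝ} (hz : ‖z - 7 / 9‖ ≤ δ) :
    7 / 9 - δ ≤ ‖z‖ ∧ ‖z‖ ≤ 7 / 9 + δ := by
  have h79 : ‖(7 / 9 : ℂ)‖ = 7 / 9 := by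
    rw [show (7 / 9 : ℂ) = ((7 / 9 : ℝ) : ℂ) by push_cast; rfl, Complex.norm_real]; norm_num
  have hu : ‖z‖ ≤ ‖z - 7 / 9‖ + ‖(7 / 9 : ℂ)‖ := by
    calc ‖z‖ = ‖(z - 7 / 9) + 7 / 9‖ := by ring_nf
      _ ≤ _ := norm_add_le _ _
  have hl : ‖(7 / 9 : ℂ)‖ ≤ ‖z‖ + ‖z - 7 / 9‖ := by
    calc ‖(7 / 9 : ℂ)‖ = ‖z - (z - 7 / 9)‖ := by ring_nf
      _ ≤ ‖z‖ + ‖z - 7 / 9‖ := norm_sub_le _ _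
  constructor <;> linarith

/-- A closed disc of radius `1/40` about a point within `29/360` of `7/9` lies in the fugacity annulus `2/3 < |ζ| < 8/9`. -/
theorem closedBall_subset_annulus {z : ℂ} (hz : ‖z - 7 / 9‖ ≤ 29 / 360) :
    closedBall z (1 / 40) ⊆ {ζ : ℂ | 2 / 3 < ‖ζ‖ ∧ ‖ζ‖ < 8 / 9} := by
  intro ζ hζ
  have h1 : ‖ζ - 7 / 9‖ ≤ 29 / 360 + 1 / 40 := by
    calc ‖ζ - 7 / 9‖ = ‖(ζ - z) + (z - 7 / 9)‖ := by ring_nf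
      _ ≤ ‖ζ - z‖ + ‖z - 7 / 9‖ := norm_add_le _ _
      _ ≤ 1 / 40 + 29 / 360 := by rw [← dist_eq_norm]; exact add_le_add (mem_closedBall.mp hζ) hz
      _ = _ := by ring
  have h2 := norm_bounds_of_near_seven_ninths h1
  constructor <;> norm_num at h2 ⊢ <;> linarith [h2.1, h2.2]

section Gradient

variable {h : ℂ × ℂ → ℂ} {ε : ℝ}
  (hh : AnalyticOnNhd ℂ h ({ζ : ℂ | 2 / 3 < ‖ζ‖ ∧ ‖ζ‖ < 8 / 9} ×ˢ {ζ : ℂ | 2 / 3 < ‖ζ‖ ∧ ‖ζ‖ < 8 / 9}))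
  (hB : ∀ p ∈ ({ζ : ℂ | 2 / 3 < ‖ζ‖ ∧ ‖ζ‖ < 8 / 9} ×ˢ {ζ : ℂ | 2 / 3 < ‖ζ‖ ∧ ‖ζ‖ < 8 / 9}), ‖h p‖ ≤ ε)
include hh hB

/-- Sup bound of the `z`-partial on the bidisc of radius `29/360`: `‖∂_z h‖ ≤ 40ε`. -/
theorem norm_fderiv_fst_le {p : ℂ × ℂ} (hp1 : ‖p.1 - 7 / 9‖ ≤ 29 / 360) (hp2 : ‖p.2 - 7 / 9‖ ≤ 29 / 360) :
    ‖fderiv ℂ h p (1, 0)‖ ≤ 40 * ε := by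
  have hsub := closedBall_subset_annulus hp1
  have hp2A : p.2 ∈ {ζ : ℂ | 2 / 3 < ‖ζ‖ ∧ ‖ζ‖ < 8 / 9} := by
    have := norm_bounds_of_near_seven_ninths hp2
    constructor <;> norm_num at this ⊢ <;> linarith [this.1, this.2]
  have hdiff : DifferentiableOn ℂ (fun z : ℂ => h (z, p.2)) (closedBall p.1 (1 / 40)) := fun z hz =>
    ((hh (z, p.2) ⟨hsub hz, hp2A⟩).differentiableAt.comp z
      (differentiableAt_id.prodMk (differentiableAt_const _))).differentiableWithinAt
  have hbd : ∀ z ∈ closedBall p.1 (1 / 40), ‖h (z, p.2)‖ ≤ ε := fun z hz => hB (z, p.2) ⟨hsub hz, hp2A⟩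
  have h1 := norm_deriv_le_of_closedBall (by norm_num) hdiff hbd
  have hpA : p ∈ {ζ : ℂ | 2 / 3 < ‖ζ‖ ∧ ‖ζ‖ < 8 / 9} ×ˢ {ζ : ℂ | 2 / 3 < ‖ζ‖ ∧ ‖ζ‖ < 8 / 9} :=
    ⟨hsub (mem_closedBall_self (by norm_num)), hp2A⟩
  rw [(hasDerivAt_fst_slice (hh p hpA).differentiableAt).deriv] at h1
  linarith

/-- Sup bound of the `w`-partial on the bidisc of radius `29/360`: `‖∂_w h‖ ≤ 40ε`. -/
theorem norm_fderiv_snd_le {p : ℂ × ℂ} (hp1 : ‖p.1 - 7 / 9‖ ≤ 29 / 360) (hp2 : ‖p.2 - 7 / 9‖ ≤ 29 / 360) :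
    ‖fderiv ℂ h p (0, 1)‖ ≤ 40 * ε := by
  have hsub := closedBall_subset_annulus hp2
  have hp1A : p.1 ∈ {ζ : ℂ | 2 / 3 < ‖ζ‖ ∧ ‖ζ‖ < 8 / 9} := by
    have := norm_bounds_of_near_seven_ninths hp1
    constructor <;> norm_num at this ⊢ <;> linarith [this.1, this.2]
  have hdiff : DifferentiableOn ℂ (fun w : ℂ => h (p.1, w)) (closedBall p.2 (1 / 40)) := fun w hw =>
    ((hh (p.1, w) ⟨hp1A, hsub hw⟩).differentiableAt.comp w
      ((differentiableAt_const _).prodMk differentiableAt_id)).differentiableWithinAt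
  have hbd : ∀ w ∈ closedBall p.2 (1 / 40), ‖h (p.1, w)‖ ≤ ε := fun w hw => hB (p.1, w) ⟨hp1A, hsub hw⟩
  have h1 := norm_deriv_le_of_closedBall (by norm_num) hdiff hbd
  have hpA : p ∈ {ζ : ℂ | 2 / 3 < ‖ζ‖ ∧ ‖ζ‖ < 8 / 9} ×ˢ {ζ : ℂ | 2 / 3 < ‖ζ‖ ∧ ‖ζ‖ < 8 / 9} :=
    ⟨hp1A, hsub (mem_closedBall_self (by norm_num))⟩
  rw [(hasDerivAt_snd_slice (hh p hpA).differentiableAt).deriv] at h1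
  linarith

omit hh hB in
/-- Points of the bidisc `D' = B̄(7/9, 29/360)²` lie in the annulus square. -/
theorem mem_annulus_sq_of_near {p : ℂ × ℂ} (hp1 : ‖p.1 - 7 / 9‖ ≤ 29 / 360) (hp2 : ‖p.2 - 7 / 9‖ ≤ 29 / 360) :
    p ∈ {ζ : ℂ | 2 / 3 < ‖ζ‖ ∧ ‖ζ‖ < 8 / 9} ×ˢ {ζ : ℂ | 2 / 3 < ‖ζ‖ ∧ ‖ζ‖ < 8 / 9} :=
  ⟨closedBall_subset_annulus hp1 (mem_closedBall_self (by norm_num)),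
    closedBall_subset_annulus hp2 (mem_closedBall_self (by norm_num))⟩

omit hB in
/-- The partial gradients `p ↦ ∂_z h(p)`, `p ↦ ∂_w h(p)` are analytic on the annulus square. -/
theorem analyticOnNhd_fderiv_apply (v : ℂ × ℂ) :
    AnalyticOnNhd ℂ (fun p => fderiv ℂ h p v)
      ({ζ : ℂ | 2 / 3 < ‖ζ‖ ∧ ‖ζ‖ < 8 / 9} ×ˢ {ζ : ℂ | 2 / 3 < ‖ζ‖ ∧ ‖ζ‖ < 8 / 9}) :=
  (ContinuousLinearMap.apply ℂ ℂ v).comp_analyticOnNhd hh.fderiv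

/-- Lipschitz bound of the partial gradient, `z`-direction: on the bidisc `D = B̄(7/9,1/18)²`,
`‖∂h(z,w)·v − ∂h(z',w)·v‖ ≤ 1600ε‖z − z'‖` (Cauchy estimate for the second derivative from the sup bound `40ε` on `D'`, then the
mean value inequality on the convex disc). -/
theorem norm_fderiv_sub_fst_le (v : ℂ × ℂ) (hv : v = (1, 0) ∨ v = (0, 1)) {w z z' : ℂ} (hw : ‖w - 7 / 9‖ ≤ 1 / 18)
    (hz : ‖z - 7 / 9‖ ≤ 1 / 18) (hz' : ‖z' - 7 / 9‖ ≤ 1 / 18) :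
    ‖fderiv ℂ h (z, w) v - fderiv ℂ h (z', w) v‖ ≤ 1600 * ε * ‖z - z'‖ := by
  have hG := analyticOnNhd_fderiv_apply hh v
  have hw' : ‖w - 7 / 9‖ ≤ 29 / 360 := hw.trans (by norm_num)
  have hsup : ∀ q : ℂ × ℂ, ‖q.1 - 7 / 9‖ ≤ 29 / 360 → ‖q.2 - 7 / 9‖ ≤ 29 / 360 → ‖fderiv ℂ h q v‖ ≤ 40 * ε := by
    intro q hq1 hq2
    rcases hv with rfl | rfl
    · exact norm_fderiv_fst_le hh hB hq1 hq2
    · exact norm_fderiv_snd_le hh hB hq1 hq2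
  have hgd : ∀ x : ℂ, ‖x - 7 / 9‖ ≤ 29 / 360 → DifferentiableAt ℂ (fun x : ℂ => fderiv ℂ h (x, w) v) x := by
    intro x hx
    have hc : DifferentiableAt ℂ (fun x : ℂ => (x, w)) x := differentiableAt_id.prodMk (differentiableAt_const w)
    have := (hG (x, w) (mem_annulus_sq_of_near hx hw')).differentiableAt.comp x hc
    exact this
  have hgb : ∀ x ∈ closedBall (7 / 9 : ℂ) (1 / 18), ‖deriv (fun x : ℂ => fderiv ℂ h (x, w) v) x‖ ≤ 1600 * ε := by
    intro x hx
    have hx' : ‖x - 7 / 9‖ ≤ 1 / 18 := by rw [← dist_eq_norm]; exact mem_closedBall.mp hx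
    have hball : ∀ y ∈ closedBall x (1 / 40), ‖y - 7 / 9‖ ≤ 29 / 360 := by
      intro y hy
      calc ‖y - 7 / 9‖ = ‖(y - x) + (x - 7 / 9)‖ := by ring_nf
        _ ≤ ‖y - x‖ + ‖x - 7 / 9‖ := norm_add_le _ _
        _ ≤ 1 / 40 + 1 / 18 := by rw [← dist_eq_norm]; exact add_le_add (mem_closedBall.mp hy) hx'
        _ = 29 / 360 := by norm_num
    have h1 := norm_deriv_le_of_closedBall (f := fun x : ℂ => fderiv ℂ h (x, w) v) (c := x) (by norm_num : (0 : ℝ) < 1 / 40)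
      (fun y hy => (hgd y (hball y hy)).differentiableWithinAt) (fun y hy => hsup (y, w) (hball y hy) hw')
    linarith
  have hF : ∀ x ∈ closedBall (7 / 9 : ℂ) (1 / 18), DifferentiableAt ℂ (fun x : ℂ => fderiv ℂ h (x, w) v) x := fun x hx =>
    hgd x ((show ‖x - 7 / 9‖ ≤ 1 / 18 by rw [← dist_eq_norm]; exact mem_closedBall.mp hx).trans (by norm_num))
  have hmv := (convex_closedBall (7 / 9 : ℂ) (1 / 18)).norm_image_sub_le_of_norm_deriv_le hF hgb
    (mem_closedBall.mpr (by rw [dist_eq_norm]; exact hz')) (mem_closedBall.mpr (by rw [dist_eq_norm]; exact hz))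
  simpa using hmv

/-- Lipschitz bound of the partial gradient, `w`-direction: on `D`, `‖∂h(z,w)·v − ∂h(z,w')·v‖ ≤ 1600ε‖w − w'‖`. -/
theorem norm_fderiv_sub_snd_le (v : ℂ × ℂ) (hv : v = (1, 0) ∨ v = (0, 1)) {z w w' : ℂ} (hz : ‖z - 7 / 9‖ ≤ 1 / 18)
    (hw : ‖w - 7 / 9‖ ≤ 1 / 18) (hw' : ‖w' - 7 / 9‖ ≤ 1 / 18) :
    ‖fderiv ℂ h (z, w) v - fderiv ℂ h (z, w') v‖ ≤ 1600 * ε * ‖w - w'‖ := by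
  have hG := analyticOnNhd_fderiv_apply hh v
  have hz' : ‖z - 7 / 9‖ ≤ 29 / 360 := hz.trans (by norm_num)
  have hsup : ∀ q : ℂ × ℂ, ‖q.1 - 7 / 9‖ ≤ 29 / 360 → ‖q.2 - 7 / 9‖ ≤ 29 / 360 → ‖fderiv ℂ h q v‖ ≤ 40 * ε := by
    intro q hq1 hq2
    rcases hv with rfl | rfl
    · exact norm_fderiv_fst_le hh hB hq1 hq2
    · exact norm_fderiv_snd_le hh hB hq1 hq2
  have hgd : ∀ y : ℂ, ‖y - 7 / 9‖ ≤ 29 / 360 → DifferentiableAt ℂ (fun y : ℂ => fderiv ℂ h (z, y) v) y := by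
    intro y hy
    have hc : DifferentiableAt ℂ (fun y : ℂ => (z, y)) y := (differentiableAt_const z).prodMk differentiableAt_id
    have := (hG (z, y) (mem_annulus_sq_of_near hz' hy)).differentiableAt.comp y hc
    exact this
  have hgb : ∀ y ∈ closedBall (7 / 9 : ℂ) (1 / 18), ‖deriv (fun y : ℂ => fderiv ℂ h (z, y) v) y‖ ≤ 1600 * ε := by
    intro y hy
    have hy' : ‖y - 7 / 9‖ ≤ 1 / 18 := by rw [← dist_eq_norm]; exact mem_closedBall.mp hy
    have hball : ∀ x ∈ closedBall y (1 / 40), ‖x - 7 / 9‖ ≤ 29 / 360 := by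
      intro x hx
      calc ‖x - 7 / 9‖ = ‖(x - y) + (y - 7 / 9)‖ := by ring_nf
        _ ≤ ‖x - y‖ + ‖y - 7 / 9‖ := norm_add_le _ _
        _ ≤ 1 / 40 + 1 / 18 := by rw [← dist_eq_norm]; exact add_le_add (mem_closedBall.mp hx) hy'
        _ = 29 / 360 := by norm_num
    have h1 := norm_deriv_le_of_closedBall (f := fun y : ℂ => fderiv ℂ h (z, y) v) (c := y) (by norm_num : (0 : ℝ) < 1 / 40)
      (fun x hx => (hgd x (hball x hx)).differentiableWithinAt) (fun x hx => hsup (z, x) hz' (hball x hx))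
    linarith
  have hF : ∀ y ∈ closedBall (7 / 9 : ℂ) (1 / 18), DifferentiableAt ℂ (fun y : ℂ => fderiv ℂ h (z, y) v) y := fun y hy =>
    hgd y ((show ‖y - 7 / 9‖ ≤ 1 / 18 by rw [← dist_eq_norm]; exact mem_closedBall.mp hy).trans (by norm_num))
  have hmv := (convex_closedBall (7 / 9 : ℂ) (1 / 18)).norm_image_sub_le_of_norm_deriv_le hF hgb
    (mem_closedBall.mpr (by rw [dist_eq_norm]; exact hw')) (mem_closedBall.mpr (by rw [dist_eq_norm]; exact hw))
  simpa using hmv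

/-- Sup (`34ε`) and Lipschitz (`2800ε`, sup norm of `ℂ × ℂ`) bounds on `D` for the perturbations `P(p) = c(p)·∂h(p)·v`, where `c` is a
coordinate projection and `v` a coordinate direction (so `P₁ = z∂_z h` and `P₂ = w∂_w h` are the cases `(fst,(1,0))`, `(snd,(0,1))`). -/
theorem perturbation_bounds (v : ℂ × ℂ) (hv : v = (1, 0) ∨ v = (0, 1)) (c : ℂ × ℂ → ℂ) (hc : c = Prod.fst ∨ c = Prod.snd) :
    (∀ p ∈ closedBall (7 / 9 : ℂ) (1 / 18) ×ˢ closedBall (7 / 9 : ℂ) (1 / 18), ‖c p * fderiv ℂ h p v‖ ≤ 34 * ε) ∧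
    ∀ p ∈ closedBall (7 / 9 : ℂ) (1 / 18) ×ˢ closedBall (7 / 9 : ℂ) (1 / 18),
      ∀ q ∈ closedBall (7 / 9 : ℂ) (1 / 18) ×ˢ closedBall (7 / 9 : ℂ) (1 / 18),
        ‖c p * fderiv ℂ h p v - c q * fderiv ℂ h q v‖ ≤ 2800 * ε * ‖p - q‖ := by
  have hD : ∀ p ∈ closedBall (7 / 9 : ℂ) (1 / 18) ×ˢ closedBall (7 / 9 : ℂ) (1 / 18),
      ‖p.1 - 7 / 9‖ ≤ 1 / 18 ∧ ‖p.2 - 7 / 9‖ ≤ 1 / 18 := fun p hp =>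
    ⟨by rw [← dist_eq_norm]; exact mem_closedBall.mp hp.1, by rw [← dist_eq_norm]; exact mem_closedBall.mp hp.2⟩
  have hsup : ∀ q : ℂ × ℂ, ‖q.1 - 7 / 9‖ ≤ 1 / 18 → ‖q.2 - 7 / 9‖ ≤ 1 / 18 → ‖fderiv ℂ h q v‖ ≤ 40 * ε := by
    intro q hq1 hq2
    rcases hv with rfl | rfl
    · exact norm_fderiv_fst_le hh hB (hq1.trans (by norm_num)) (hq2.trans (by norm_num))
    · exact norm_fderiv_snd_le hh hB (hq1.trans (by norm_num)) (hq2.trans (by norm_num))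
  have hcn : ∀ p : ℂ × ℂ, ‖p.1 - 7 / 9‖ ≤ 1 / 18 → ‖p.2 - 7 / 9‖ ≤ 1 / 18 → ‖c p‖ ≤ 15 / 18 := by
    intro p hp1 hp2
    rcases hc with rfl | rfl
    · have := (norm_bounds_of_near_seven_ninths hp1).2; norm_num at this ⊢; linarith
    · have := (norm_bounds_of_near_seven_ninths hp2).2; norm_num at this ⊢; linarith
  have hcl : ∀ p q : ℂ × ℂ, ‖c p - c q‖ ≤ ‖p - q‖ := by
    intro p q
    rcases hc with rfl | rfl
    · exact norm_fst_le (p - q)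
    · exact norm_snd_le (p - q)
  refine ⟨fun p hp => ?_, ?_⟩
  · obtain ⟨h1, h2⟩ := hD p hp
    have hg := hsup p h1 h2
    have hε0 : 0 ≤ ε := by linarith [norm_nonneg (fderiv ℂ h p v)]
    rw [norm_mul]
    calc ‖c p‖ * ‖fderiv ℂ h p v‖ ≤ 15 / 18 * (40 * ε) := by gcongr; exact hcn p h1 h2
      _ ≤ 34 * ε := by linarith
  rintro ⟨p1, p2⟩ hp ⟨q1, q2⟩ hq
  obtain ⟨hp1, hp2⟩ := hD _ hp
  obtain ⟨hq1, hq2⟩ := hD _ hq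
  have hg := hsup (p1, p2) hp1 hp2
  have hε0 : 0 ≤ ε := by linarith [norm_nonneg (fderiv ℂ h (p1, p2) v)]
  have t1 := norm_fderiv_sub_fst_le hh hB v hv hp2 hp1 hq1
  have t2 := norm_fderiv_sub_snd_le hh hB v hv hq1 hp2 hq2
  have n1 : ‖p1 - q1‖ ≤ ‖((p1, p2) : ℂ × ℂ) - (q1, q2)‖ := norm_fst_le (((p1, p2) : ℂ × ℂ) - (q1, q2))
  have n2 : ‖p2 - q2‖ ≤ ‖((p1, p2) : ℂ × ℂ) - (q1, q2)‖ := norm_snd_le (((p1, p2) : ℂ × ℂ) - (q1, q2))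
  have n3 := hcl (p1, p2) (q1, q2)
  have n4 := hcn (q1, q2) hq1 hq2
  have hpq := norm_nonneg (((p1, p2) : ℂ × ℂ) - (q1, q2))
  calc ‖c (p1, p2) * fderiv ℂ h (p1, p2) v - c (q1, q2) * fderiv ℂ h (q1, q2) v‖
      = ‖(c (p1, p2) - c (q1, q2)) * fderiv ℂ h (p1, p2) v +
          c (q1, q2) * ((fderiv ℂ h (p1, p2) v - fderiv ℂ h (q1, p2) v) +
            (fderiv ℂ h (q1, p2) v - fderiv ℂ h (q1, q2) v))‖ := by ring_nf
    _ ≤ ‖c (p1, p2) - c (q1, q2)‖ * ‖fderiv ℂ h (p1, p2) v‖ +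
          ‖c (q1, q2)‖ * (‖fderiv ℂ h (p1, p2) v - fderiv ℂ h (q1, p2) v‖ +
            ‖fderiv ℂ h (q1, p2) v - fderiv ℂ h (q1, q2) v‖) := by
        refine (norm_add_le _ _).trans ?_
        rw [norm_mul, norm_mul]
        gcongr
        exact norm_add_le _ _
    _ ≤ ‖((p1, p2) : ℂ × ℂ) - (q1, q2)‖ * (40 * ε) +
          15 / 18 * (1600 * ε * ‖((p1, p2) : ℂ × ℂ) - (q1, q2)‖ + 1600 * ε * ‖((p1, p2) : ℂ × ℂ) - (q1, q2)‖) := by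
        gcongr
        · exact t1.trans (by gcongr)
        · exact t2.trans (by gcongr)
    _ ≤ 2800 * ε * ‖((p1, p2) : ℂ × ℂ) - (q1, q2)‖ := by nlinarith

/-- **§6 — the base point of the saddle.** For `h` analytic on the annulus square with `‖h‖ ≤ ε ≤ 1/28000`
there, and real targets `α, β` within `1/300` of `7/16`, the perturbed saddle equations `z/(1+z) + z∂_z h = α`,
`w/(1+w) + w∂_w h = β` have a solution `(z₀, w₀)` in the bidisc `B̄(7/9, 1/18)²`, with `‖z₀∂_z h‖, ‖w₀∂_w h‖ ≤ 34ε`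
and `(z₀, w₀)` within `(81/25)·34ε` of the real unperturbed saddle `(α/(1−α), β/(1−β))`. -/
theorem exists_saddle_base_point (hε : ε ≤ 1 / 28000) (α β : ℝ) (hα : |α - 7 / 16| ≤ 1 / 300)
    (hβ : |β - 7 / 16| ≤ 1 / 300) :
    ∃ p ∈ closedBall (7 / 9 : ℂ) (1 / 18) ×ˢ closedBall (7 / 9 : ℂ) (1 / 18),
      p.1 / (1 + p.1) + p.1 * fderiv ℂ h p (1, 0) = α ∧ p.2 / (1 + p.2) + p.2 * fderiv ℂ h p (0, 1) = β ∧
      ‖p.1 * fderiv ℂ h p (1, 0)‖ ≤ 34 * ε ∧ ‖p.2 * fderiv ℂ h p (0, 1)‖ ≤ 34 * ε ∧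
      ‖p.1 - ((α / (1 - α) : ℝ) : ℂ)‖ ≤ 81 / 25 * (34 * ε) ∧ ‖p.2 - ((β / (1 - β) : ℝ) : ℂ)‖ ≤ 81 / 25 * (34 * ε) := by
  obtain ⟨hS1, hL1⟩ := perturbation_bounds hh hB (1, 0) (Or.inl rfl) Prod.fst (Or.inl rfl)
  obtain ⟨hS2, hL2⟩ := perturbation_bounds hh hB (0, 1) (Or.inr rfl) Prod.snd (Or.inr rfl)
  have hreal : ∀ γ : ℝ, |γ - 7 / 16| ≤ 1 / 300 → ‖(γ : ℂ) - 7 / 16‖ ≤ 1 / 300 := by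
    intro γ hγ
    rw [show (γ : ℂ) - 7 / 16 = ((γ - 7 / 16 : ℝ) : ℂ) by push_cast; ring, Complex.norm_real, Real.norm_eq_abs]
    exact hγ
  have hα' := hreal α hα
  have hβ' := hreal β hβ
  obtain ⟨p, hp, -, -, h1, h2, e1, e2⟩ := exists_perturbed_saddle_point (α : ℂ) (β : ℂ) hα' hβ'
    (fun p => p.1 * fderiv ℂ h p (1, 0)) (fun p => p.2 * fderiv ℂ h p (0, 1)) (lam := 2800 * ε) (by linarith)
    (fun q hq => (hS1 q hq).trans (by linarith)) (fun q hq => (hS2 q hq).trans (by linarith)) hL1 hL2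
  refine ⟨p, hp, e1, e2, hS1 p hp, hS2 p hp, ?_, ?_⟩
  · have hg : ((α / (1 - α) : ℝ) : ℂ) = (α : ℂ) / (1 - (α : ℂ)) := by push_cast; ring
    rw [hg, h1]
    refine (norm_moebiusInv_sub_moebiusInv_le ?_ (hα'.trans (by norm_num))).trans ?_
    · calc ‖(α : ℂ) - p.1 * fderiv ℂ h p (1, 0) - 7 / 16‖
            = ‖((α : ℂ) - 7 / 16) - p.1 * fderiv ℂ h p (1, 0)‖ := by ring_nf
        _ ≤ ‖(α : ℂ) - 7 / 16‖ + ‖p.1 * fderiv ℂ h p (1, 0)‖ := norm_sub_le _ _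
        _ ≤ 1 / 300 + 34 * ε := add_le_add hα' (hS1 p hp)
        _ ≤ 1 / 150 := by linarith
    · have : ‖(α : ℂ) - p.1 * fderiv ℂ h p (1, 0) - α‖ = ‖p.1 * fderiv ℂ h p (1, 0)‖ := by
        rw [show (α : ℂ) - p.1 * fderiv ℂ h p (1, 0) - α = -(p.1 * fderiv ℂ h p (1, 0)) by ring, norm_neg]
      rw [this]
      linarith [hS1 p hp]
  · have hg : ((β / (1 - β) : ℝ) : ℂ) = (β : ℂ) / (1 - (β : ℂ)) := by push_cast; ring
    rw [hg, h2]
    refine (norm_moebiusInv_sub_moebiusInv_le ?_ (hβ'.trans (by norm_num))).trans ?_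
    · calc ‖(β : ℂ) - p.2 * fderiv ℂ h p (0, 1) - 7 / 16‖
            = ‖((β : ℂ) - 7 / 16) - p.2 * fderiv ℂ h p (0, 1)‖ := by ring_nf
        _ ≤ ‖(β : ℂ) - 7 / 16‖ + ‖p.2 * fderiv ℂ h p (0, 1)‖ := norm_sub_le _ _
        _ ≤ 1 / 300 + 34 * ε := add_le_add hβ' (hS2 p hp)
        _ ≤ 1 / 150 := by linarith
    · have : ‖(β : ℂ) - p.2 * fderiv ℂ h p (0, 1) - β‖ = ‖p.2 * fderiv ℂ h p (0, 1)‖ := by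
        rw [show (β : ℂ) - p.2 * fderiv ℂ h p (0, 1) - β = -(p.2 * fderiv ℂ h p (0, 1)) by ring, norm_neg]
      rw [this]
      linarith [hS2 p hp]

end Gradient

end Summit.Ventures.CertifiedManyBodySolver.Theorems.TcThermcert1.ZeroFreeCorridor

end
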